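import Literature.Computability.AlgebraicComplexity.LoweringUnipotentMaps
import HarnessLib

/-!
# Borel-fixed normal form without the fixed point theorem: unipotent moves lower a graded potential

Topic `Literature/Computability/AlgebraicComplexity`. Over `LoweringUnipotentMaps.lean` (graded
subspaces `IsGraded`, lowering unipotent maps `IsLowering`) and `WeightInitialSubspace.lean` (the
torus limit `WtInit.stage`, its dimension and gradedness), written for the Borel-fixed border
apolarity lower bounds of Conner–Harper–Landsberg 2023 (§2.4: "we may assume that `E_{ijk}` is
Borel fixed"; there via the Borel fixed point theorem on a product of Grassmannians). Here the
Borel part is ELEMENTARY. For a graded `E ≤ K^σ` and a lowering `u`: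

* `WtInit.finrank_Fge_map_le` — `dim (uE ∩ V_{≥ d}) ≤ dim (E ∩ V_{≥ d})` for every `d` (truncate a
  preimage to its part of degree `≥ d`; injective because `u` preserves `V_{<d}`), so the
  POTENTIAL `WtInit.pot deg F d₀ n = ∑_{i<n} dim (F ∩ V_{≥ d₀+i})` (Abel-summed form of
  `∑_d d · dim in_d F`, the total torus weight) satisfies `pot (uE) ≤ pot E` (`WtInit.pot_map_le`);
* `WtInit.map_eq_of_finrank_Fge_eq`, `WtInit.map_eq_of_pot_map_eq` — equality forces `uE = E`
  (a homogeneous `f' ∈ E` is `u f` for the preimage `f` truncating to `f'`: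
  `u f - f' ∈ V_{<d} ∩ V_{≥d} = 0`);
* `WtInit.pot_stage_eq`, `WtInit.isGraded_stage` — the torus limit `in(G) = stage deg G d₀ n`
  keeps the potential and is graded;
* `WtInit.exists_fixed_of_forall_stage_map`, `WtInit.exists_fixed_triple` — **Borel-fixed normal
  form**: if a property of graded subspaces (resp. of triples of subspaces of three graded spaces,
  moved simultaneously — the `(110)`, `(011)`, `(101)` candidates of one decomposition) is preserved
  by `E ↦ in(u_a E)` for a family of lowering maps `u_a`, then a potential-MINIMAL graded subspace
  with the property is fixed by every `u_a`. With the `u_a` the root elements of a Borel `𝔹` this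
  is CHL's normal form, by explicit degenerations (as for generic initial ideals) instead of the
  fixed point theorem.

Everything PROVED.

## References

* A. Conner, A. Harper, J. M. Landsberg, *New lower bounds for matrix multiplication and `det₃`*,
  Forum Math. Pi 11 (2023) e17 = arXiv:1911.07981, §2.4–§2.5. [ConnerHarperLandsberg2023]

## Design

The potential is a natural number (window `[d₀, d₀+n)` containing all degrees), so minimal elements
exist by `Nat.find`; the family `u_a` need not be finite.
-/

noncomputable section

open scoped BigOperators

namespace Literature.Computability.AlgebraicComplexity

namespace WtInit

universe u v

variable {K : Type u} [Field K] {σ : Type v} {deg : σ → ℤ}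

/-! ## The potential drops under a lowering map, with equality only at fixed subspaces -/

section Potential

variable {u : (σ → K) →ₗ[K] (σ → K)} {E : Submodule K (σ → K)}

variable (deg) in
/-- The preimage in `E` of `uE ∩ V_{≥ d}`: `T_d = {f ∈ E | u f ∈ V_{≥ d}}`. [folklore] -/
def preFge (u : (σ → K) →ₗ[K] (σ → K)) (E : Submodule K (σ → K)) (d : ℤ) : Submodule K (σ → K) :=
  E ⊓ (Vge deg d).comap u

variable (deg) in
/-- `u` maps `T_d` onto `uE ∩ V_{≥ d}`. [folklore] -/
theorem map_preFge_eq (d : ℤ) : (preFge deg u E d).map u = Fge deg (E.map u) d := by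
  apply le_antisymm
  · rintro _ ⟨f, ⟨hfE, hfV⟩, rfl⟩
    exact ⟨Submodule.mem_map_of_mem hfE, hfV⟩
  · rintro y ⟨⟨f, hfE, rfl⟩, hyV⟩
    exact ⟨f, ⟨hfE, hyV⟩, rfl⟩

variable (deg) in
/-- The truncation `f ↦ f - projLt d f` on `T_d`, as a linear map. [folklore] -/
def truncMap (u : (σ → K) →ₗ[K] (σ → K)) (E : Submodule K (σ → K)) (d : ℤ) :
    preFge deg u E d →ₗ[K] (σ → K) :=
  (LinearMap.id - projLt (K := K) deg d).comp (preFge deg u E d).subtype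

variable (deg) in
/-- Entries of the truncation map. [folklore] -/
@[simp] theorem truncMap_apply (d : ℤ) (f : preFge deg u E d) :
    truncMap deg u E d f = (f : σ → K) - projLt deg d f := rfl

variable [Fintype σ]

variable (deg) in
/-- `dim (uE ∩ V_{≥ d}) ≤ dim T_d`. [folklore] -/
theorem finrank_Fge_map_le_preFge (d : ℤ) :
    Module.finrank K (Fge deg (E.map u) d) ≤ Module.finrank K (preFge deg u E d) := by
  rw [← map_preFge_eq deg]
  exact Submodule.finrank_map_le _ _

/-- The truncation maps `T_d` into `E ∩ V_{≥ d}` (for a graded `E`). [folklore] -/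
theorem range_truncMap_le (hE : IsGraded deg E) (d : ℤ) :
    LinearMap.range (truncMap deg u E d) ≤ Fge deg E d := by
  rintro _ ⟨f, rfl⟩
  exact hE.sub_projLt_mem_Fge d f.2.1

/-- **The truncation is injective on `T_d`**: a vector of `T_d` with no component of degree `≥ d`
lies in `V_{<d}`, so does its image (`u` is lowering), which also lies in `V_{≥ d}`. [folklore] -/
theorem truncMap_injective (hu : IsLowering deg u) (d : ℤ) :
    Function.Injective (truncMap deg u E d) := by
  rw [← LinearMap.ker_eq_bot, Submodule.eq_bot_iff]
  intro f hf
  rw [LinearMap.mem_ker, truncMap_apply, sub_eq_zero] at hf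
  have h1 : u f ∈ Vlt deg d := hu.map_mem_Vlt (hf ▸ projLt_mem_Vlt deg d (f : σ → K))
  have h2 : u f ∈ Vge deg d := f.2.2
  have h3 : u f = 0 := eq_zero_of_mem_Vlt_of_mem_Vge deg h1 h2
  have h4 : (f : σ → K) = 0 := hu.injective (by rw [h3, map_zero])
  exact Subtype.ext h4

variable (hu : IsLowering deg u) (hE : IsGraded deg E)
include hu hE

/-- **`dim (uE ∩ V_{≥ d}) ≤ dim (E ∩ V_{≥ d})`** for a graded `E` and a lowering `u`.
[cite: ConnerHarperLandsberg2023, §2.4] -/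
theorem finrank_Fge_map_le (d : ℤ) :
    Module.finrank K (Fge deg (E.map u) d) ≤ Module.finrank K (Fge deg E d) := by
  refine (finrank_Fge_map_le_preFge deg d).trans ?_
  rw [← LinearMap.finrank_range_of_inj (truncMap_injective hu d)]
  exact Submodule.finrank_mono (range_truncMap_le hE d)

/-- **Equality of the counts forces `uE ⊇ E` degree by degree.** If
`dim (uE ∩ V_{≥ d}) = dim (E ∩ V_{≥ d})` then every homogeneous `f' ∈ E` of degree `d` is `u f`
for some `f ∈ E`: take `f ∈ T_d` truncating to `f'`; then `u f - f' ∈ V_{<d} ∩ V_{≥ d} = 0`.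
[cite: ConnerHarperLandsberg2023, §2.4] -/
theorem projDeg_mem_map_of_finrank_Fge_eq {d : ℤ}
    (h : Module.finrank K (Fge deg (E.map u) d) = Module.finrank K (Fge deg E d))
    {x : σ → K} (hx : x ∈ E) : projDeg deg d x ∈ E.map u := by
  -- the truncation `T_d → E ∩ V_{≥ d}` is onto
  have hle1 := finrank_Fge_map_le_preFge deg (u := u) (E := E) d
  have hinj := truncMap_injective (E := E) hu d
  have hrange : LinearMap.range (truncMap deg u E d) = Fge deg E d := by
    apply Submodule.eq_of_le_of_finrank_eq (range_truncMap_le hE d)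
    apply le_antisymm (Submodule.finrank_mono (range_truncMap_le hE d))
    rw [LinearMap.finrank_range_of_inj hinj]
    omega
  set f' := projDeg deg d x with hf'
  have hf'E : f' ∈ Fge deg E d :=
    ⟨hE d x hx, (mem_Vge deg).2 fun s hs => by simp [hf', projDeg, show deg s ≠ d by omega]⟩
  rw [← hrange] at hf'E
  obtain ⟨f, hf⟩ := hf'E
  rw [truncMap_apply] at hf
  -- `u f = f'`
  have hlow1 : u f' - f' ∈ Vlt deg d := hu d f' (isHomog_projDeg deg d x)
  have hlow2 : u (projLt deg d (f : σ → K)) ∈ Vlt deg d := hu.map_mem_Vlt (projLt_mem_Vlt deg d _)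
  have hsplit : u (f : σ → K) = u f' + u (projLt deg d (f : σ → K)) := by
    rw [← map_add]
    congr 1
    rw [← hf]
    abel
  have hdiff : u f - f' = (u f' - f') + u (projLt deg d (f : σ → K)) := by
    rw [hsplit]
    abel
  have hVlt : u f - f' ∈ Vlt deg d := hdiff ▸ Submodule.add_mem _ hlow1 hlow2
  have hVge : u f - f' ∈ Vge deg d := by
    refine Submodule.sub_mem _ f.2.2 ((mem_Vge deg).2 fun s hs => ?_)
    simp [hf', projDeg, show deg s ≠ d by omega]
  have heq : u f = f' := sub_eq_zero.1 (eq_zero_of_mem_Vlt_of_mem_Vge deg hVlt hVge)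
  exact ⟨f, f.2.1, heq⟩

/-- **`uE = E` when the counts agree in every degree.** [cite: ConnerHarperLandsberg2023, §2.4] -/
theorem map_eq_of_finrank_Fge_eq
    (h : ∀ d, Module.finrank K (Fge deg (E.map u) d) = Module.finrank K (Fge deg E d)) :
    E.map u = E := by
  have hle : E ≤ E.map u :=
    le_of_projDeg_mem deg fun d x hx => projDeg_mem_map_of_finrank_Fge_eq hu hE (h d) hx
  refine (Submodule.eq_of_le_of_finrank_eq hle ?_).symm
  exact LinearEquiv.finrank_eq (Submodule.equivMapOfInjective u hu.injective E)

omit hu hE in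
variable (deg) in
/-- **The potential** of a subspace over the window `[d₀, d₀ + n)`:
`pot F = ∑_{i<n} dim (F ∩ V_{≥ d₀+i})` — by `finrank_Fge_eq_sum` this is `∑_i i · dim in_{d₀+i} F`
up to the constant `dim F`, i.e. the total torus weight of `F`. [folklore] -/
def pot (F : Submodule K (σ → K)) (d₀ : ℤ) (n : ℕ) : ℕ :=
  ∑ i ∈ Finset.range n, Module.finrank K (Fge deg F (d₀ + i))

/-- The potential does not increase under a lowering map. [folklore] -/
theorem pot_map_le (d₀ : ℤ) (n : ℕ) : pot deg (E.map u) d₀ n ≤ pot deg E d₀ n :=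
  Finset.sum_le_sum fun i _ => finrank_Fge_map_le hu hE (d₀ + i)

/-- **Equal potential over a window containing all degrees forces `uE = E`.** [folklore] -/
theorem map_eq_of_pot_map_eq {d₀ : ℤ} {n : ℕ} (hlo : ∀ s, d₀ ≤ deg s) (hhi : ∀ s, deg s < d₀ + n)
    (h : pot deg (E.map u) d₀ n = pot deg E d₀ n) : E.map u = E := by
  have hterm := (Finset.sum_eq_sum_iff_of_le (s := Finset.range n)
    fun i _ => finrank_Fge_map_le hu hE (d₀ + i)).1 h
  refine map_eq_of_finrank_Fge_eq hu hE fun d => ?_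
  have hdim : Module.finrank K (E.map u) = Module.finrank K E :=
    (LinearEquiv.finrank_eq (Submodule.equivMapOfInjective u hu.injective E)).symm
  rcases lt_or_ge d (d₀ + n) with hd | hd
  · rcases le_or_gt d d₀ with hd' | hd'
    · rw [Fge_eq_of_le deg _ fun s => hd'.trans (hlo s), Fge_eq_of_le deg _ fun s => hd'.trans (hlo s),
        hdim]
    · obtain ⟨i, hi, rfl⟩ : ∃ i : ℕ, i < n ∧ d = d₀ + i := ⟨(d - d₀).toNat, by omega, by omega⟩
      exact hterm i (Finset.mem_range.2 hi)
  · rw [Fge_eq_bot_of_lt deg _ fun s => (hhi s).trans_le hd,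
      Fge_eq_bot_of_lt deg _ fun s => (hhi s).trans_le hd]

end Potential

/-! ## The torus limit keeps the potential -/

section Stage

variable (deg)
variable (G : Submodule K (σ → K)) {d₀ : ℤ} {n : ℕ}

/-- The pieces of `G` are pieces of its torus limit: `in_d G ≤ in_d (stage G)` for `d` in the
window. [folklore] -/
theorem inPart_le_inPart_stage {i : ℕ} (hi : i < n) :
    inPart deg G (d₀ + i) ≤ inPart deg (stage deg G d₀ n) (d₀ + i) := by
  rintro x ⟨ψ, hψ, rfl⟩
  have hx : projDeg deg (d₀ + i) ψ ∈ stage deg G d₀ n :=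
    projDeg_mem_stage_of_mem deg G d₀ hi hψ.1 hψ.2
  have hxV : projDeg deg (d₀ + i) ψ ∈ Vge deg (d₀ + i) := (mem_Vge deg).2 fun s hs => by
    simp [projDeg, show deg s ≠ d₀ + i by omega]
  refine ⟨projDeg deg (d₀ + i) ψ, ⟨hx, hxV⟩, ?_⟩
  funext s
  by_cases h : deg s = d₀ + i <;> simp [projDeg, h]

variable [Fintype σ] (hlo : ∀ s, d₀ ≤ deg s) (hhi : ∀ s, deg s < d₀ + n)
include hlo hhi

/-- The torus limit has the same pieces DIMENSION-wise: `dim in_d (stage G) = dim in_d G`.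
[folklore] -/
theorem finrank_inPart_stage_eq {i : ℕ} (hi : i < n) :
    Module.finrank K (inPart deg (stage deg G d₀ n) (d₀ + i)) =
      Module.finrank K (inPart deg G (d₀ + i)) := by
  have hle : ∀ j ∈ Finset.range n, Module.finrank K (inPart deg G (d₀ + j)) ≤
      Module.finrank K (inPart deg (stage deg G d₀ n) (d₀ + j)) :=
    fun j hj => Submodule.finrank_mono (inPart_le_inPart_stage deg G (Finset.mem_range.1 hj))
  have hsum : ∑ j ∈ Finset.range n, Module.finrank K (inPart deg G (d₀ + j)) =
      ∑ j ∈ Finset.range n, Module.finrank K (inPart deg (stage deg G d₀ n) (d₀ + j)) := by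
    rw [← finrank_eq_sum_finrank_inPart deg G d₀ n hlo hhi,
      ← finrank_eq_sum_finrank_inPart deg (stage deg G d₀ n) d₀ n hlo hhi, finrank_stage_eq deg G hlo hhi]
  exact ((Finset.sum_eq_sum_iff_of_le hle).1 hsum i (Finset.mem_range.2 hi)).symm

/-- `dim (stage G ∩ V_{≥ d}) = dim (G ∩ V_{≥ d})` for `d` in the window. [folklore] -/
theorem finrank_Fge_stage_eq {i : ℕ} (hi : i ≤ n) :
    Module.finrank K (Fge deg (stage deg G d₀ n) (d₀ + i)) = Module.finrank K (Fge deg G (d₀ + i)) := by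
  have h1 := finrank_Fge_eq_sum deg (stage deg G d₀ n) (d₀ + i) (n - i)
  have h2 := finrank_Fge_eq_sum deg G (d₀ + i) (n - i)
  have htop : d₀ + (i : ℤ) + ((n - i : ℕ) : ℤ) = d₀ + n := by push_cast [Nat.cast_sub hi]; ring
  rw [htop, Fge_eq_bot_of_lt deg _ hhi, finrank_bot, add_zero] at h1 h2
  rw [h1, h2]
  refine Finset.sum_congr rfl fun j hj => ?_
  have hj' := Finset.mem_range.1 hj
  have : d₀ + (i : ℤ) + (j : ℤ) = d₀ + ((i + j : ℕ) : ℤ) := by push_cast; ring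
  rw [this]
  exact finrank_inPart_stage_eq deg G hlo hhi (by omega)

/-- **The torus limit keeps the potential**: `pot (stage G) = pot G`. [folklore] -/
theorem pot_stage_eq : pot deg (stage deg G d₀ n) d₀ n = pot deg G d₀ n :=
  Finset.sum_congr rfl fun _ hi => finrank_Fge_stage_eq deg G hlo hhi (Finset.mem_range.1 hi).le

omit [Fintype σ] hlo hhi in
/-- The torus limit is graded. [folklore] -/
theorem isGraded_stage : IsGraded deg (stage deg G d₀ n) :=
  fun d _ hx => projDeg_mem_stage deg G d₀ n hx d

end Stage

/-! ## Potential-minimal graded subspaces are fixed -/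

section Fixed

variable (deg) [Fintype σ]

/-- **Borel-fixed normal form, one space.** Let `u_a` be lowering maps and `P` a property of
subspaces such that some graded subspace has `P`, and `P E`, `E` graded imply
`P (in(u_a E))` (`= stage deg (E.map (u a)) d₀ n`) for every `a`. Then some graded subspace with
`P` is fixed by every `u_a`: one of minimal potential. [cite: ConnerHarperLandsberg2023, §2.4] -/
theorem exists_fixed_of_forall_stage_map {ι : Type*} (us : ι → ((σ → K) →ₗ[K] (σ → K)))
    (hus : ∀ a, IsLowering deg (us a)) (P : Submodule K (σ → K) → Prop) {d₀ : ℤ} {n : ℕ}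
    (hlo : ∀ s, d₀ ≤ deg s) (hhi : ∀ s, deg s < d₀ + n)
    (hP : ∃ E, P E ∧ IsGraded deg E)
    (hstab : ∀ E, P E → IsGraded deg E → ∀ a, P (stage deg (E.map (us a)) d₀ n)) :
    ∃ E, P E ∧ IsGraded deg E ∧ ∀ a, E.map (us a) = E := by
  classical
  have hex : ∃ m, ∃ E, P E ∧ IsGraded deg E ∧ pot deg E d₀ n = m := by
    obtain ⟨E, hPE, hgE⟩ := hP
    exact ⟨_, E, hPE, hgE, rfl⟩
  obtain ⟨E, hPE, hgE, hpot⟩ := Nat.find_spec hex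
  have hmin : ∀ E', P E' → IsGraded deg E' → pot deg E d₀ n ≤ pot deg E' d₀ n := by
    intro E' hP' hg'
    rw [hpot]
    exact Nat.find_min' hex ⟨E', hP', hg', rfl⟩
  refine ⟨E, hPE, hgE, fun a => ?_⟩
  have h1 := hmin _ (hstab E hPE hgE a) (isGraded_stage deg _)
  rw [pot_stage_eq deg _ hlo hhi] at h1
  have h2 := pot_map_le (hus a) hgE d₀ n
  exact map_eq_of_pot_map_eq (hus a) hgE hlo hhi (le_antisymm h2 h1)

variable {σ₂ σ₃ : Type v} [Fintype σ₂] [Fintype σ₃] (deg₂ : σ₂ → ℤ) (deg₃ : σ₃ → ℤ)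

/-- **Borel-fixed normal form, three spaces moved simultaneously** (the `(110)`, `(011)`, `(101)`
candidates of one border rank decomposition under the same group element): with lowering maps
`u¹_a, u²_a, u³_a` on three graded coordinate spaces and a property `P` of triples preserved by the
simultaneous move-and-degenerate, some graded triple with `P` is fixed by all of them.
[cite: ConnerHarperLandsberg2023, §2.4] -/
theorem exists_fixed_triple {ι : Type*} (us₁ : ι → ((σ → K) →ₗ[K] (σ → K)))
    (us₂ : ι → ((σ₂ → K) →ₗ[K] (σ₂ → K))) (us₃ : ι → ((σ₃ → K) →ₗ[K] (σ₃ → K)))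
    (hus₁ : ∀ a, IsLowering deg (us₁ a)) (hus₂ : ∀ a, IsLowering deg₂ (us₂ a))
    (hus₃ : ∀ a, IsLowering deg₃ (us₃ a))
    (P : Submodule K (σ → K) → Submodule K (σ₂ → K) → Submodule K (σ₃ → K) → Prop)
    {d₀ : ℤ} {n : ℕ} (hlo₁ : ∀ s, d₀ ≤ deg s) (hhi₁ : ∀ s, deg s < d₀ + n)
    (hlo₂ : ∀ s, d₀ ≤ deg₂ s) (hhi₂ : ∀ s, deg₂ s < d₀ + n)
    (hlo₃ : ∀ s, d₀ ≤ deg₃ s) (hhi₃ : ∀ s, deg₃ s < d₀ + n)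
    (hP : ∃ E₁ E₂ E₃, P E₁ E₂ E₃ ∧ IsGraded deg E₁ ∧ IsGraded deg₂ E₂ ∧ IsGraded deg₃ E₃)
    (hstab : ∀ E₁ E₂ E₃, P E₁ E₂ E₃ → IsGraded deg E₁ → IsGraded deg₂ E₂ → IsGraded deg₃ E₃ →
      ∀ a, P (stage deg (E₁.map (us₁ a)) d₀ n) (stage deg₂ (E₂.map (us₂ a)) d₀ n)
        (stage deg₃ (E₃.map (us₃ a)) d₀ n)) :
    ∃ E₁ E₂ E₃, P E₁ E₂ E₃ ∧ IsGraded deg E₁ ∧ IsGraded deg₂ E₂ ∧ IsGraded deg₃ E₃ ∧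
      ∀ a, E₁.map (us₁ a) = E₁ ∧ E₂.map (us₂ a) = E₂ ∧ E₃.map (us₃ a) = E₃ := by
  classical
  have hex : ∃ m, ∃ E₁ E₂ E₃, P E₁ E₂ E₃ ∧ IsGraded deg E₁ ∧ IsGraded deg₂ E₂ ∧ IsGraded deg₃ E₃ ∧
      pot deg E₁ d₀ n + pot deg₂ E₂ d₀ n + pot deg₃ E₃ d₀ n = m := by
    obtain ⟨E₁, E₂, E₃, hPE, hg₁, hg₂, hg₃⟩ := hP
    exact ⟨_, E₁, E₂, E₃, hPE, hg₁, hg₂, hg₃, rfl⟩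
  obtain ⟨E₁, E₂, E₃, hPE, hg₁, hg₂, hg₃, hpot⟩ := Nat.find_spec hex
  have hmin : ∀ E₁' E₂' E₃', P E₁' E₂' E₃' → IsGraded deg E₁' → IsGraded deg₂ E₂' →
      IsGraded deg₃ E₃' → pot deg E₁ d₀ n + pot deg₂ E₂ d₀ n + pot deg₃ E₃ d₀ n ≤
        pot deg E₁' d₀ n + pot deg₂ E₂' d₀ n + pot deg₃ E₃' d₀ n := by
    intro E₁' E₂' E₃' hP' hg₁' hg₂' hg₃'
    rw [hpot]
    exact Nat.find_min' hex ⟨E₁', E₂', E₃', hP', hg₁', hg₂', hg₃', rfl⟩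
  refine ⟨E₁, E₂, E₃, hPE, hg₁, hg₂, hg₃, fun a => ?_⟩
  have h1 := hmin _ _ _ (hstab E₁ E₂ E₃ hPE hg₁ hg₂ hg₃ a) (isGraded_stage deg _)
    (isGraded_stage deg₂ _) (isGraded_stage deg₃ _)
  rw [pot_stage_eq deg _ hlo₁ hhi₁, pot_stage_eq deg₂ _ hlo₂ hhi₂, pot_stage_eq deg₃ _ hlo₃ hhi₃] at h1
  have h2₁ := pot_map_le (hus₁ a) hg₁ d₀ n
  have h2₂ := pot_map_le (hus₂ a) hg₂ d₀ n
  have h2₃ := pot_map_le (hus₃ a) hg₃ d₀ n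
  exact ⟨map_eq_of_pot_map_eq (hus₁ a) hg₁ hlo₁ hhi₁ (by omega),
    map_eq_of_pot_map_eq (hus₂ a) hg₂ hlo₂ hhi₂ (by omega),
    map_eq_of_pot_map_eq (hus₃ a) hg₃ hlo₃ hhi₃ (by omega)⟩

end Fixed

end WtInit

end Literature.Computability.AlgebraicComplexity

end
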